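import Summits.Ventures.PercRepro.RankLevelSetExplicitLin2KeyQuart

/-!
# PercRepro — THE LEVEL-13 QUART ROW OF C-025: THE KEY AT `p = 17 876` AND THE CONDITIONAL LEVEL STEP (p9, S4)

`proofs/SUBCLAIM-S4-p9.md` §S4.2⁗‴. The saturated row of record at level `13` is `p ≥ 85 609` (RankLevelSetExplicitLin2RowThirteen).
With p4's quart multiplicity the assembled inequality `(P_d)` holds, exactly evaluated, at EVERY core corank `14 ≤ d ≤ 8205`
from `p = 17 876` — and fails at `p = 17 875` (corank `5 106`, the big class's saturation corank):
the quart key `KeyQ 13 17876 d` (RankLevelSetExplicitLin2KeyQuart) is checked by the kernel at the 8 192 coranks (`decide`, 2 chunks of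
4 096), and `c025_level_succ_of_keyQ_row` turns the row into the level step
**`c025_thirteen_quart_step (hprev : ∀ M p, 17 875 ≤ p → RLS M p 12) : ∀ M p, 17 876 ≤ p → RLS M p 13`** (N₁(13) = 16 778,
tail `16 454`). The unconditional rows are composed in RankLevelSetExplicitLin2QuartFloor. Axioms: standard.
-/

open scoped Matroid

namespace PercRepro

namespace ThmN

namespace Explicit

/-- The quart key row at `(q, p) = (13, 17 876)`, chunk 1 of 2: coranks `14 … 4109`, by the kernel. -/
theorem key_thirteen_quart_row_1 : ∀ t < 4096, KeyQ 13 17876 (14 + t) := by decide +kernel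

/-- The quart key row at `(q, p) = (13, 17 876)`, chunk 2 of 2: coranks `4110 … 8205`, by the kernel. -/
theorem key_thirteen_quart_row_2 : ∀ t < 4096, KeyQ 13 17876 (14 + (4096 + t)) := by decide +kernel

/-- **THE QUART KEY ROW AT `(q, p) = (13, 17 876)`**: `KeyQ 13 17876 d` at every corank `14 ≤ d ≤ 8205` (the 2 chunks). -/
theorem key_thirteen_quart_row : ∀ t < 8192, KeyQ 13 17876 (14 + t) :=
  ball_lt_add (fun t => KeyQ 13 17876 (14 + t)) 4096 4096
    (key_thirteen_quart_row_1) key_thirteen_quart_row_2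

/-- **THE QUART FLOOR IS EXACT**: the quart key FAILS at `p = 17 875`, corank `5 106` (the big class's saturation corank), by the kernel. -/
theorem key_thirteen_quart_sharp : ¬ KeyQ 13 17875 5106 := by decide +kernel

end Explicit

variable {α : Type}

/-- **THE LEVEL-13 QUART STEP FROM `17 876`**: level `13` for every finite matroid and every `p ≥ 17 876` from level `12` for
every `p ≥ 17 875` — the quart key row at `17 876`, its monotonicity in `p`, and the wrapper `c025_level_succ_of_keyQ_row`
(`N₁(13) = 16 778 ≤ 17 876`, tail `16 454 ≤ 17 876`). -/
theorem c025_thirteen_quart_step (hprev : ∀ (M : Matroid α) [M.Finite] (p : ℕ), 17875 ≤ p → RLS M p 12) :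
    ∀ (M : Matroid α) [M.Finite] (p : ℕ), 17876 ≤ p → RLS M p 13 :=
  c025_level_succ_of_keyQ_row 12 (by norm_num) 17876 (by norm_num) (by norm_num) Explicit.key_thirteen_quart_row hprev

end ThmN

end PercRepro
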